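import Mathlib
import HarnessLib
import Summits.ResolutionOfSingularities.ResolutionOfSingularities.Theorems.WildQuotientsWildQuotientResolutionS1aKillFreeF

/-!
# S1a — K-FREE FRAME, R-F14b: the research statement with a FREE ROOT DECORATION (`ReachLowerInFX`), and the skeleton-v13 derivations

[OURS · L1 W4.5c · lead-1 g12; plan-1 A-KF v1 §1.4 (S2)/R-F14b «DEFERRED AMENDMENT, approved: at the next skeleton touch replace `P (initial) (ofNodeAtlas h₀)` by
`∃ 𝔄₀, P (initial) 𝔄₀` (strictly weaker stub, same kernel proof, h₀ keeps guaranteeing existence)»] — NOT statements of the manuscript; counted 0; AI-level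
work, weaker than expert review. Crux stmt-ResolutionOfSingularities-17941 `CyclicQuotientFourfolds`, line `s1a-logminvertex` (v12 → v13).

WHY: the stub's root decoration `NodeAtlasData.ofNodeAtlas h₀` is CHOSEN from a Prop, so its formal locus `F_unk` is known only up to `badLocus ⊆ F_unk ⊆ Fix(g₀)`
((F-T5) ✓p660451) and a root obligation can only be met by leaves with `F = ∅`; letting the producer START from its own explicit atlas `𝔄₀` removes the
artefact (the first REFINEMENT node of every census master tree) without touching the kernel (`wins_of_reachLowerInF` is stated for any `𝔄₀`).
* research def `ReachLowerInFX p` (OURS CANDIDATE, asserted nowhere): binders VERBATIM those of `ReachLowerInF`, conclusion `∃ 𝔄₀ P, P (initial hq h₀) 𝔄₀ ∧ …`;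
* `reachLowerInFX_of_reachLowerInF` (take `𝔄₀ := ofNodeAtlas h₀`) — v13's stub is WEAKER than v12's;
* ★ `winningStrategy_of_reachLowerInFX`, `cyclicQuotientFourfolds_of_door_of_reachLowerInFX` (skeleton v13 composition);
* `reachLowerInFX_datum_of_exists` — the instance interface: an instance proving `∃ P, P (initial hq h₀) 𝔄₀ ∧ …` for SOME explicit `𝔄₀` (as
  `exists_reachLowerF_initial_of_jordanBlock` ✓p660379 does for every `𝔄₀`) discharges the datum's clause of `ReachLowerInFX`.
-/

set_option linter.dupNamespace false

noncomputable section

open CategoryTheory Limits AlgebraicGeometry TopologicalSpace Topology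
open Literature.AlgebraicGeometry.Resolution Literature.AlgebraicGeometry.RelativeSpec
open Summit.ResolutionOfSingularities.ResolutionOfSingularities.Theorems.WildQuotientResolution.S1
open Summit.ResolutionOfSingularities.ResolutionOfSingularities.Theorems.WildQuotientResolution.S1.NodeAtlas
open Summit.ResolutionOfSingularities.ResolutionOfSingularities.Theorems.WildQuotientResolution.S1.NpFrame

namespace Summit.ResolutionOfSingularities.ResolutionOfSingularities.Theorems.WildQuotientResolution.S1

/-- **`ReachLowerInFX p`** (OURS CANDIDATE research statement — the research stub of skeleton v13 —, asserted nowhere; binders VERBATIM those of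
`ReachLowerInF`; R-F14b): for every datum of the crux there are a ROOT DECORATION `𝔄₀` of the initial model (any node-atlas data — e.g. the plain atlas
`ofNodeAtlas h₀`, or the producer's own explicit charts) and a class `P ∋ (initial, 𝔄₀)` of decorated models such that from every non-terminal decorated
`P`-model some bounded strategy tree inside `P` reaches decorated models of lexicographically lower `μ_F`. [OURS · L1 W4.5c · R-F14b] -/
def ReachLowerInFX (p : ℕ) : Prop :=
  ∀ (k : Type) [Field k] [CharP k p] [PerfectField k] (X' X₁ : Scheme.{0})
    (f : X₁ ⟶ Spec (.of k)) (q : X' ⟶ X₁) (G : Type) [Group G] [Finite G]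
    (ρ : G →* Aut X'), Nat.card G = p → IsSeparated f → LocallyOfFiniteType f → QuasiCompact f →
    IsIntegral X₁ → ∀ [IsIntegral X'], Scheme.IsRegular X' → IsFinite q → Function.Surjective q.base →
    (∃ U : X₁.Opens, Dense (U : Set X₁) ∧ Etale (q ∣_ U)) →
    ∀ (hq : ∀ g : G, (ρ g).hom ≫ q = q),
    (∀ x y : X', q.base x = q.base y → ∃ g : G, (ρ g).hom.base x = y) →
    topologicalKrullDim X₁ ≤ 4 → Function.Injective ρ →
    ∀ (g₀ : G), (∀ g : G, g ∈ Subgroup.zpowers g₀) → ∀ [IsLocallyNoetherian X']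
      (h₀ : NodeAtlas p (⟨ρ, hq⟩ : ActionOver q G) g₀),
      ∃ (𝔄₀ : NodeAtlasData p (GameFrame.GModel.initial hq h₀).act g₀)
        (P : ∀ M : GameFrame.GModel p q G ρ g₀, NodeAtlasData p M.act g₀ → Prop),
        P (GameFrame.GModel.initial hq h₀) 𝔄₀ ∧
        ∀ (M : GameFrame.GModel p q G ρ g₀) (𝔄 : NodeAtlasData p M.act g₀), P M 𝔄 → ¬ M.Terminal →
          ∃ n : ℕ, GameFrame.GModel.TreeF P (fun N 𝔅 => GameFrame.GModel.LexLTF N 𝔅 M 𝔄) n M 𝔄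

/-- **v13's stub is weaker than v12's**: `ReachLowerInF p → ReachLowerInFX p` (take the plain atlas as root decoration). [OURS · L1 W4.5c · R-F14b] -/
theorem reachLowerInFX_of_reachLowerInF {p : ℕ} (h : ReachLowerInF p) : ReachLowerInFX p := by
  intro k _ _ _ X' X₁ f q G _ _ ρ hG hfs hfft hfqc hX₁ _ hreg hqfin hqs hqet hq horb hdim hinj g₀ hg₀ _ h₀
  obtain ⟨P, hP₀, H⟩ := h k X' X₁ f q G ρ hG hfs hfft hfqc hX₁ hreg hqfin hqs hqet hq horb hdim hinj g₀ hg₀ h₀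
  exact ⟨_, P, hP₀, H⟩

/-- ★ **`ReachLowerInFX p ⇒ WinningStrategy p`** (same kernel proof as `winningStrategy_of_reachLowerInF`: `wins_of_reachLowerInF` for the root pair
`(initial, 𝔄₀)`). [OURS · L1 W4.5c · R-F14b] -/
theorem winningStrategy_of_reachLowerInFX {p : ℕ} (h : ReachLowerInFX p) : FrameWins.WinningStrategy p := by
  intro k _ _ _ X' X₁ f q G _ _ ρ hG hfs hfft hfqc hX₁ _ hreg hqfin hqs hqet hq horb hdim hinj g₀ hg₀ _ h₀
  haveI := hfft
  haveI := hfqc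
  haveI := hqfin
  obtain ⟨𝔄₀, P, hP₀, H⟩ := h k X' X₁ f q G ρ hG hfs hfft hfqc hX₁ hreg hqfin hqs hqet hq horb hdim hinj g₀ hg₀ h₀
  exact GameFrame.GModel.wins_of_reachLowerInF P (fun M 𝔄 _ => GameFrame.GModel.exists_nat_fdim_lt_of_datum f M 𝔄) H _ 𝔄₀ hP₀

/-- **Door + `ReachLowerInFX` ⇒ the sub-crux `CyclicQuotientFourfolds`** (skeleton v13 composition pattern). [OURS · L1 W4.5c · R-F14b] -/
theorem cyclicQuotientFourfolds_of_door_of_reachLowerInFX (hD : FrameWins.DoorStatement) (h : ∀ p : ℕ, p.Prime → ReachLowerInFX p) :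
    Summit.ResolutionOfSingularities.ResolutionOfSingularities.Theses.WildQuotients.CyclicQuotientFourfolds :=
  FrameWins.cyclicQuotientFourfolds_of_door_of_wins hD fun p hp _ => winningStrategy_of_reachLowerInFX (h p hp)

/-- **The instance interface**: for a fixed datum, `∃ P, P (initial hq h₀) 𝔄₀ ∧ …` for SOME root decoration `𝔄₀` is the datum's clause of
`ReachLowerInFX` — the shape delivered by instance theorems (`exists_reachLowerF_initial_of_jordanBlock`, every `𝔄₀`). [OURS · L1 W4.5c · R-F14b] -/
theorem reachLowerInFX_datum_of_exists {p : ℕ} {X' X₁ : Scheme.{0}} {q : X' ⟶ X₁} {G : Type} [Group G] {ρ : G →* Aut X'} {g₀ : G}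
    {hq : ∀ g : G, (ρ g).hom ≫ q = q} [IsIntegral X'] [IsLocallyNoetherian X'] {h₀ : NodeAtlas p (⟨ρ, hq⟩ : ActionOver q G) g₀}
    (𝔄₀ : NodeAtlasData p (GameFrame.GModel.initial hq h₀).act g₀)
    (h : ∃ P : ∀ M : GameFrame.GModel p q G ρ g₀, NodeAtlasData p M.act g₀ → Prop,
      P (GameFrame.GModel.initial hq h₀) 𝔄₀ ∧
      ∀ (M : GameFrame.GModel p q G ρ g₀) (𝔄 : NodeAtlasData p M.act g₀), P M 𝔄 → ¬ M.Terminal →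
        ∃ n : ℕ, GameFrame.GModel.TreeF P (fun N 𝔅 => GameFrame.GModel.LexLTF N 𝔅 M 𝔄) n M 𝔄) :
    ∃ (𝔄₀ : NodeAtlasData p (GameFrame.GModel.initial hq h₀).act g₀)
      (P : ∀ M : GameFrame.GModel p q G ρ g₀, NodeAtlasData p M.act g₀ → Prop),
      P (GameFrame.GModel.initial hq h₀) 𝔄₀ ∧
      ∀ (M : GameFrame.GModel p q G ρ g₀) (𝔄 : NodeAtlasData p M.act g₀), P M 𝔄 → ¬ M.Terminal →
        ∃ n : ℕ, GameFrame.GModel.TreeF P (fun N 𝔅 => GameFrame.GModel.LexLTF N 𝔅 M 𝔄) n M 𝔄 :=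
  ⟨𝔄₀, h⟩

end Summit.ResolutionOfSingularities.ResolutionOfSingularities.Theorems.WildQuotientResolution.S1

end
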